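import Mathlib
import HarnessLib
import Summits.Ventures.LatticeQCDFlow.Exactness.NCMCGeneralSpaceEventTauIntPositive

/-!
# A Doeblin POWER does not force a positive asymptotic variance for a general bounded observable: a three-state kernel with `κ²(x, ·) ≥ ½ ν`, NO one-step minorisation, and a three-valued centred observable with `Var_π f = 2/3` whose Green–Kubo variance is EXACTLY `0`

HONEST FRAMING: exact (Metropolis-corrected) sampling algorithms for lattice gauge theory;
figures of merit are autocorrelation/cost numbers at stated couplings and volumes; no
continuum-physics claim.

Venture `LatticeQCDFlow` (cell pub-lqcd), topic `Exactness`; FANOUT row 13 (`eng-snf`, GEN-21).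
NEW WORK of the cell (an explicit example), not a published result; no definition is introduced;
nothing is cited as a fact.  GEN-20's `NCMCGeneralSpaceAsymptoticVarianceLowerBound` proves
`σ²_f ≥ (e/(2e+4)) Var_π f` for EVERY bounded observable under a ONE-step minorisation and asked for
the `m`-step version; GEN-21's `NCMCGeneralSpaceEventTauIntPositive` proves positivity under any
Doeblin power for EVENTS (two-valued observables).  THIS file shows that two-valuedness (or
reversibility, or the one-step shape) cannot be dropped: on `Fin 3` take
`κ(0, ·) = κ(1, ·) = ½δ₁ + ½δ₂`, `κ(2, ·) = δ₀`; the uniform law `π` is invariant,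
`κ²(x, ·) ≥ ½ · (½δ₁ + ½δ₂)` for every `x` (a Doeblin SQUARE with `ε = ½`), NO one-step minorisation
exists (`κ(2, ·) = δ₀ ⊥ κ(0, ·)`), and for `h = (0, 1, 1)` one has `κh = (1, 1, 0)`, so the centred
observable `f = h − κh = (−1, 0, 1)` has `Var_π f = 2/3` while its partial sums TELESCOPE
(`h(X_{t+1}) = κh(X_t)` surely: `h` is constant on the support of every row), whence
`σ²_f = π(h²) − π((κh)²) = 2/3 − 2/3 = 0`.  By GEN-19's martingale form of the Green–Kubo variance
(`integral_sq_sub_sq_kop_eq_greenKubo_of_nHit`, valid under the Doeblin square),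
`C_f(0) + 2 Σ_{t≥1} C_f(t) = 0`.

## Content

* `bind_add_measure`, `bind_smul_measure` — `bind` is additive and homogeneous in the initial law.
* `integral_fin3` — `∫ g dμ = Σ_i μ{i} g(i)` on `Fin 3`.
* **`exists_doeblinSquare_zero_asymptoticVariance`** — the example, as an existential statement over
  `Fin 3`: a Markov kernel `κ`, an invariant probability law `π`, a probability law `ν` with
  `½ • ν ≤ (nHit κ 2)(z, ·)` for all `z`, NO `(ε, ν')` with `ε ≠ 0` and `ε • ν' ≤ κ(z, ·)` for all `z`,
  and a measurable `f` with `|f| ≤ 1`, `∫ f dπ = 0`, `∫ f² dπ = 2/3`, and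
  `autocov κ π f̄ 0 + 2 Σ' autocov κ π f̄ (t+1) = 0` (`f̄ = f − πf = f`).

NOT CLAIMED: anything about reversible kernels (there a Doeblin power does give a floor), events
(positivity holds, GEN-21), or any engine kernel.
-/

namespace Summit.Ventures.LatticeQCDFlow.Exactness.GeneralNCMC

open MeasureTheory ProbabilityTheory Set Filter Finset
open scoped ENNReal NNReal Topology

/-! ## §1 Two bookkeeping lemmas -/

section Helpers

variable {S : Type*} [MeasurableSpace S]

/-- `bind` is additive in the initial law. -/
theorem bind_add_measure (κ : Kernel S S) (μ₁ μ₂ : Measure S) :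
    (μ₁ + μ₂).bind κ = μ₁.bind κ + μ₂.bind κ := by
  ext s hs
  rw [Measure.bind_apply hs (Kernel.aemeasurable κ), lintegral_add_measure, Measure.add_apply,
    Measure.bind_apply hs (Kernel.aemeasurable κ), Measure.bind_apply hs (Kernel.aemeasurable κ)]

/-- `bind` is homogeneous in the initial law. -/
theorem bind_smul_measure (κ : Kernel S S) (a : ℝ≥0∞) (μ : Measure S) :
    (a • μ).bind κ = a • μ.bind κ := by
  ext s hs
  rw [Measure.bind_apply hs (Kernel.aemeasurable κ), lintegral_smul_measure, Measure.smul_apply,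
    Measure.bind_apply hs (Kernel.aemeasurable κ), smul_eq_mul]

/-- Integrals on `Fin 3`: `∫ g dμ = μ{0} g 0 + μ{1} g 1 + μ{2} g 2` (finite `μ`). -/
theorem integral_fin3 (μ : Measure (Fin 3)) [IsFiniteMeasure μ] (g : Fin 3 → ℝ) :
    ∫ x, g x ∂μ = (μ {0}).toReal * g 0 + (μ {1}).toReal * g 1 + (μ {2}).toReal * g 2 := by
  rw [integral_fintype Integrable.of_finite]
  simp only [smul_eq_mul, Fin.sum_univ_three, measureReal_def]

end Helpers

/-! ## §2 The example -/

/-- **A DOEBLIN SQUARE WITH A DEGENERATE ASYMPTOTIC VARIANCE.**  On `Fin 3` there are a Markov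
kernel `κ`, an invariant probability law `π`, a probability law `ν` and a bounded measurable
observable `f` such that: `½ • ν ≤ (nHit κ 2)(z, ·)` for every `z` (two-step Doeblin minorisation);
NO one-step minorisation `ε • ν' ≤ κ(z, ·)` (`ε ≠ 0`, `ν'` a probability law) exists; `∫ f dπ = 0`,
`∫ f² dπ = 2/3` (so `f` is not `π`-a.s. constant); and the Green–Kubo asymptotic variance of `f`
VANISHES: `autocov κ π f̄ 0 + 2 Σ'_t autocov κ π f̄ (t+1) = 0`. -/
theorem exists_doeblinSquare_zero_asymptoticVariance :
    ∃ (κ : Kernel (Fin 3) (Fin 3)) (_ : IsMarkovKernel κ) (π ν : Measure (Fin 3))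
      (_ : IsProbabilityMeasure π) (_ : IsProbabilityMeasure ν) (f : Fin 3 → ℝ),
      Kernel.Invariant κ π ∧ (∀ z, (2⁻¹ : ℝ≥0∞) • ν ≤ nHit κ 2 z) ∧
      (¬ ∃ (ε : ℝ≥0∞) (ν' : Measure (Fin 3)), IsProbabilityMeasure ν' ∧ ε ≠ 0 ∧ ∀ z, ε • ν' ≤ κ z) ∧
      Measurable f ∧ (∀ x, |f x| ≤ 1) ∧ ∫ x, f x ∂π = 0 ∧ ∫ x, f x ^ 2 ∂π = 2 / 3 ∧
      Scoring.autocov κ π (fun y => f y - ∫ z, f z ∂π) 0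
        + 2 * ∑' t, Scoring.autocov κ π (fun y => f y - ∫ z, f z ∂π) (t + 1) = 0 := by
  -- the rows: `κ(0) = κ(1) = ν = ½δ₁ + ½δ₂`, `κ(2) = δ₀`
  obtain ⟨ν, hν⟩ : ∃ ν : Measure (Fin 3),
      ν = (2⁻¹ : ℝ≥0∞) • Measure.dirac 1 + (2⁻¹ : ℝ≥0∞) • Measure.dirac 2 := ⟨_, rfl⟩
  have hν0 : ν {0} = 0 := by rw [hν]; simp
  have hν1 : ν {1} = 2⁻¹ := by rw [hν]; simp
  have hν2 : ν {2} = 2⁻¹ := by rw [hν]; simp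
  haveI hνP : IsProbabilityMeasure ν := ⟨by
    rw [hν]; simp [ENNReal.inv_two_add_inv_two]⟩
  obtain ⟨kf, hkf⟩ : ∃ kf : Fin 3 → Measure (Fin 3),
      ∀ z, kf z = if z = 2 then Measure.dirac 0 else ν := ⟨fun z => if z = 2 then _ else ν, fun _ => rfl⟩
  set κ : Kernel (Fin 3) (Fin 3) := Kernel.ofFunOfCountable kf with hκdef
  have hκ : ∀ z, κ z = if z = 2 then Measure.dirac 0 else ν := fun z => hkf z
  have hκ0 : κ 0 = ν := by rw [hκ]; simp
  have hκ1 : κ 1 = ν := by rw [hκ]; simp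
  have hκ2 : κ 2 = Measure.dirac 0 := by rw [hκ]; simp
  haveI hMk : IsMarkovKernel κ := ⟨fun z => by rw [hκ z]; split_ifs <;> infer_instance⟩
  -- the uniform law
  obtain ⟨π, hπdef⟩ : ∃ π : Measure (Fin 3),
      π = (3⁻¹ : ℝ≥0∞) • (Measure.dirac 0 + Measure.dirac 1 + Measure.dirac 2) := ⟨_, rfl⟩
  have hπ0 : π {0} = 3⁻¹ := by rw [hπdef]; simp
  have hπ1 : π {1} = 3⁻¹ := by rw [hπdef]; simp
  have hπ2 : π {2} = 3⁻¹ := by rw [hπdef]; simp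
  have h3 : ((3⁻¹ : ℝ≥0∞)).toReal = 1 / 3 := by
    rw [ENNReal.toReal_inv]; norm_num
  haveI hπP : IsProbabilityMeasure π := ⟨by
    rw [hπdef, Measure.smul_apply, smul_eq_mul]
    simp only [Measure.add_apply, measure_univ]
    rw [show (1 : ℝ≥0∞) + 1 + 1 = 3 by norm_num]
    exact ENNReal.inv_mul_cancel (by norm_num) (by simp)⟩
  -- `ν.bind κ = ½ κ(1) + ½ κ(2) = ½ ν + ½ δ₀`, `δ₀.bind κ = κ 0 = ν`
  have hbindν : ν.bind κ = (2⁻¹ : ℝ≥0∞) • ν + (2⁻¹ : ℝ≥0∞) • Measure.dirac 0 := by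
    conv_lhs => rw [hν]
    rw [bind_add_measure, bind_smul_measure, bind_smul_measure, Measure.dirac_bind κ.measurable,
      Measure.dirac_bind κ.measurable, hκ1, hκ2]
  have hbindδ : (Measure.dirac (0 : Fin 3)).bind κ = ν := by
    rw [Measure.dirac_bind κ.measurable, hκ0]
  -- invariance of `π`
  have hinv : Kernel.Invariant κ π := by
    show π.bind κ = π
    rw [hπdef, bind_smul_measure, bind_add_measure, bind_add_measure, Measure.dirac_bind κ.measurable,
      Measure.dirac_bind κ.measurable, Measure.dirac_bind κ.measurable, hκ0, hκ1, hκ2, hν]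
    ext s _
    simp only [Measure.add_apply, Measure.smul_apply, smul_eq_mul]
    have h22 : ∀ a : ℝ≥0∞, 2⁻¹ * a + 2⁻¹ * a = a := fun a => by
      rw [← add_mul, ENNReal.inv_two_add_inv_two, one_mul]
    congr 1
    calc 2⁻¹ * Measure.dirac 1 s + 2⁻¹ * Measure.dirac 2 s
          + (2⁻¹ * Measure.dirac 1 s + 2⁻¹ * Measure.dirac 2 s) + Measure.dirac 0 s
        = Measure.dirac 0 s + (2⁻¹ * Measure.dirac 1 s + 2⁻¹ * Measure.dirac 1 s)
          + (2⁻¹ * Measure.dirac 2 s + 2⁻¹ * Measure.dirac 2 s) := by ring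
      _ = Measure.dirac 0 s + Measure.dirac 1 s + Measure.dirac 2 s := by rw [h22, h22]
  -- the Doeblin square
  have hsq : ∀ z, (2⁻¹ : ℝ≥0∞) • ν ≤ nHit κ 2 z := by
    intro z
    rw [nHit_two, Kernel.comp_apply, hκ z]
    split_ifs with hz
    · rw [hbindδ]
      calc (2⁻¹ : ℝ≥0∞) • ν ≤ (1 : ℝ≥0∞) • ν :=
            smul_measure_mono (ENNReal.inv_le_one.2 one_le_two) ν
        _ = ν := one_smul _ _
    · rw [hbindν]
      exact Measure.le_add_right le_rfl
  -- no one-step minorisation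
  have hno : ¬ ∃ (ε : ℝ≥0∞) (ν' : Measure (Fin 3)), IsProbabilityMeasure ν' ∧ ε ≠ 0 ∧
      ∀ z, ε • ν' ≤ κ z := by
    rintro ⟨ε, ν', hν', hε, hle⟩
    have hz : ∀ (i : Fin 3), ε • ν' ≤ κ 0 → ε • ν' ≤ κ 2 → ν' {i} = 0 := by
      intro i h0 h2
      have e0 := Measure.le_iff'.1 h0 {i}
      have e2 := Measure.le_iff'.1 h2 {i}
      rw [Measure.smul_apply, smul_eq_mul, hκ0] at e0
      rw [Measure.smul_apply, smul_eq_mul, hκ2] at e2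
      have : ε * ν' {i} = 0 := by
        fin_cases i
        · exact le_antisymm (by simpa [hν0] using e0) bot_le
        · exact le_antisymm (by simpa using e2) bot_le
        · exact le_antisymm (by simpa using e2) bot_le
      exact (mul_eq_zero.1 this).resolve_left hε
    have hsum : ν' univ = ∑ i : Fin 3, ν' {i} := by
      rw [sum_measure_singleton, Finset.coe_univ]
    rw [measure_univ, Fin.sum_univ_three, hz 0 (hle 0) (hle 2), hz 1 (hle 0) (hle 2),
      hz 2 (hle 0) (hle 2), add_zero, add_zero] at hsum
    exact one_ne_zero hsum
  -- the observable `f = (−1, 0, 1) = h − κh` with `h = (0, 1, 1)`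
  obtain ⟨f, hf⟩ : ∃ f : Fin 3 → ℝ, ∀ z, f z = if z = 0 then -1 else if z = 1 then 0 else 1 :=
    ⟨fun z => if z = 0 then -1 else if z = 1 then 0 else 1, fun _ => rfl⟩
  obtain ⟨h, hh⟩ : ∃ h : Fin 3 → ℝ, ∀ z, h z = if z = 0 then 0 else 1 :=
    ⟨fun z => if z = 0 then 0 else 1, fun _ => rfl⟩
  have hf0 : f 0 = -1 := by rw [hf]; simp
  have hf1 : f 1 = 0 := by rw [hf]; simp
  have hf2 : f 2 = 1 := by rw [hf]; simp
  have hh0 : h 0 = 0 := by rw [hh]; simp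
  have hh1 : h 1 = 1 := by rw [hh]; simp
  have hh2 : h 2 = 1 := by rw [hh]; simp
  have hfm : Measurable f := measurable_of_countable f
  have hhm : Measurable h := measurable_of_countable h
  have hfb : ∀ x, |f x| ≤ 1 := fun x => by
    rw [hf]; split_ifs <;> simp
  have hhb : ∀ x, |h x| ≤ 1 := fun x => by
    rw [hh]; split_ifs <;> simp
  -- integrals against `π` and the rows
  have hmean : ∫ x, f x ∂π = 0 := by
    rw [integral_fin3, hπ0, hπ1, hπ2, h3, hf0, hf1, hf2]; norm_num
  have hvar : ∫ x, f x ^ 2 ∂π = 2 / 3 := by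
    rw [integral_fin3, hπ0, hπ1, hπ2, h3, hf0, hf1, hf2]; norm_num
  have hkopν : ∫ x, h x ∂ν = 1 := by
    rw [integral_fin3, hν0, hν1, hν2, hh0, hh1, hh2, ENNReal.toReal_inv]; norm_num
  have hkop : ∀ z, Scoring.kop κ h z = if z = 2 then 0 else 1 := by
    intro z
    unfold Scoring.kop
    rw [hκ z]
    split_ifs with hz
    · rw [integral_dirac, hh0]
    · exact hkopν
  have hkop0 : Scoring.kop κ h 0 = 1 := by rw [hkop]; simp
  have hkop1 : Scoring.kop κ h 1 = 1 := by rw [hkop]; simp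
  have hkop2 : Scoring.kop κ h 2 = 0 := by rw [hkop]; simp
  -- the Poisson equation `h − κh = f` (pointwise)
  have hpois : ∀ x, h x - Scoring.kop κ h x = f x - ∫ z, f z ∂π := by
    intro x
    rw [hmean, sub_zero]
    fin_cases x
    · simp [hh0, hkop0, hf0]
    · simp [hh1, hkop1, hf1]
    · simp [hh2, hkop2, hf2]
  -- the martingale form of the Green–Kubo variance under the Doeblin square
  have hminS : ∀ x {B : Set (Fin 3)}, MeasurableSet B → 2⁻¹ * ν B ≤ nHit κ 2 x B :=
    fun z B hB => minorised_setwise hsq z hB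
  have hε0 : (0 : ℝ≥0∞) < 2⁻¹ := by simp
  have hε1 : (2⁻¹ : ℝ≥0∞) ≤ 1 := ENNReal.inv_le_one.2 one_le_two
  obtain ⟨hfb', hCfb, hfb0⟩ := Scoring.centred_observable_bounds π hfm hfb
  have hGK := integral_sq_sub_sq_kop_eq_greenKubo_of_nHit hminS hε0 hε1 (by norm_num : 0 < 2) hinv
    hfb' hCfb hfb0 hhm hhb hpois
  -- `∫ h² dπ = ∫ (κh)² dπ = 2/3`
  have hh2i : ∫ x, h x ^ 2 ∂π = 2 / 3 := by
    rw [integral_fin3, hπ0, hπ1, hπ2, h3, hh0, hh1, hh2]; norm_num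
  have hk2i : ∫ x, (Scoring.kop κ h x) ^ 2 ∂π = 2 / 3 := by
    rw [integral_fin3, hπ0, hπ1, hπ2, h3, hkop0, hkop1, hkop2]; norm_num
  have h0 : Scoring.autocov κ π (fun y => f y - ∫ z, f z ∂π) 0
      = ∫ x, (f x - ∫ z, f z ∂π) ^ 2 ∂π := by
    unfold Scoring.autocov
    simp only [Function.iterate_zero, id_eq, sq]
  refine ⟨κ, hMk, π, ν, hπP, hνP, f, hinv, hsq, hno, hfm, hfb, hmean, hvar, ?_⟩
  rw [h0, ← hGK, hh2i, hk2i, sub_self]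

end Summit.Ventures.LatticeQCDFlow.Exactness.GeneralNCMC
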